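import Summits.FinalStateConjecture.FinalStateConjecture.Theorems.PhotonSphereChannelsCauchyWaveRegularity
import Summits.FinalStateConjecture.FinalStateConjecture.Theorems.PhotonSphereChannelsBlindnessWaveSolution
import Summits.FinalStateConjecture.FinalStateConjecture.Theorems.PhotonSphereChannelsRWPotential
import Literature.Geometry.Lorentzian.ReggeWheelerTortoise
import Literature.Geometry.Lorentzian.ReggeWheelerChannels

/-!
# Route PhotonSphereChannels — the 1+1 wave equation with a potential: global `C²` solutions for
# GENERAL compactly supported Cauchy data; the Regge–Wheeler Cauchy problem with velocity data

Support file for item stmt-FinalStateConjecture-10045 (`UniformPhotonSphereChannels`); proves the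
registered stub **`stub_rwCauchy`** of line `kruskal-rest-frame-virial` verbatim.

* `exists_solution` — for `V ∈ C¹(ℝ)` bounded, `A ∈ C²` and `B ∈ C¹` vanishing off `[α, β]`, there
  is `ψ ∈ C²(ℝ²)` with `ψ_tt − ψ_xx + V ψ = 0` everywhere (`iteratedDeriv` form of the route),
  `ψ(0,·) = A`, `ψ_t(0,·) = B`, and `ψ(t,x) = 0` for `x < α − |t|` or `x > β + |t|`.  Proof: as in
  `Blindness.exists_even_solution` (prover seat 3, item 10049) — Picard for the characteristic
  Volterra pair (`exists_picard_fixedPoint`, whose second datum is an arbitrary bounded continuous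
  function; here `D = A' − B`), the `C²` bootstrap with independent diagonal datum
  (`CauchyWave.contDiff_two_psi`, …), and the chain rule back to `(t, x)`
  (`iteratedDeriv_two_time_sub_space`); no symmetrisation.
* `stub_rwCauchy` — the Regge–Wheeler instance: `V = V_{s,ℓ} ∘ r` along a tortoise radius
  function is `C¹` and bounded (`0 ≤ V ≤ (ℓ(ℓ+1)+1)/(2M)²`), data `(0, g)`.

No definitions are introduced.
-/

noncomputable section

open Set Filter MeasureTheory intervalIntegral Topology Function

namespace Summit.FinalStateConjecture.FinalStateConjecture.Theorems.CauchyWave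

open Summit.FinalStateConjecture.FinalStateConjecture.Theorems.Blindness
  (exists_picard_fixedPoint iteratedDeriv_two_time_sub_space hasDerivAt_transfer_time
   contDiff_two_transfer exists_abs_le_of_eq_zero_off deriv_eq_zero_off contDiff_one_deriv_of_two)

/-- **Global `C²` solutions of `ψ_tt − ψ_xx + Vψ = 0` with general compactly supported Cauchy data.**
For `V ∈ C¹(ℝ)` bounded, `A ∈ C²(ℝ)` and `B ∈ C¹(ℝ)` vanishing off `[α, β]`, there is a global
classical solution with `ψ(0,·) = A`, `ψ_t(0,·) = B`, vanishing outside the domain of influence of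
`[α, β]`. -/
theorem exists_solution {V A B : ℝ → ℝ} {CV α β : ℝ} (hV : ContDiff ℝ 1 V)
    (hVb : ∀ x, |V x| ≤ CV) (hA : ContDiff ℝ 2 A) (hA0 : ∀ x, x ∉ Icc α β → A x = 0)
    (hB : ContDiff ℝ 1 B) (hB0 : ∀ x, x ∉ Icc α β → B x = 0) :
    ∃ ψ : ℝ → ℝ → ℝ, ContDiff ℝ 2 (uncurry ψ) ∧
      (∀ t x, iteratedDeriv 2 (fun τ => ψ τ x) t - iteratedDeriv 2 (ψ t) x + V x * ψ t x = 0) ∧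
      (∀ x, ψ 0 x = A x) ∧ (∀ x, deriv (fun τ => ψ τ x) 0 = B x) ∧
      (∀ t x, (x < α - |t| ∨ β + |t| < x) → ψ t x = 0) := by
  -- the coefficient in null coordinates
  set c : ℝ → ℝ → ℝ := fun a b => V ((a + b) / 2) / 4 with hc_def
  have hc : ContDiff ℝ 1 (uncurry c) := by
    show ContDiff ℝ 1 fun p : ℝ × ℝ => V ((p.1 + p.2) / 2) / 4
    exact (hV.comp ((contDiff_fst.add contDiff_snd).div_const 2)).div_const 4
  have hcc : Continuous (uncurry c) := hc.continuous
  have hcb : ∀ a b, |c a b| ≤ CV / 4 := fun a b => by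
    rw [hc_def]; dsimp only; rw [abs_div, abs_of_pos (by norm_num : (0:ℝ) < 4)]
    exact div_le_div_of_nonneg_right (hVb _) (by norm_num)
  -- the diagonal datum `D = A' − B`
  have hA' : ContDiff ℝ 1 (deriv A) := contDiff_one_deriv_of_two hA
  have hA'0 : ∀ b, (b < α ∨ β < b) → deriv A b = 0 := fun b hb => deriv_eq_zero_off hA0 hb
  set D : ℝ → ℝ := fun b => deriv A b - B b with hD_def
  have hD : ContDiff ℝ 1 D := hA'.sub hB
  have hnot : ∀ x, (x < α ∨ β < x) → x ∉ Icc α β := fun x hx h => by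
    rcases hx with hx | hx
    · exact (not_le.2 hx) h.1
    · exact (not_le.2 hx) h.2
  have hD0 : ∀ b, (b < α ∨ β < b) → D b = 0 := fun b hb => by
    simp only [hD_def, hA'0 b hb, hB0 b (hnot b hb), sub_zero]
  have hD0' : ∀ x, x ∉ Icc α β → D x = 0 := fun x hx => hD0 x (by
    by_contra h
    exact hx ⟨le_of_not_gt fun h' => h (Or.inl h'), le_of_not_gt fun h' => h (Or.inr h')⟩)
  obtain ⟨MA, hMA⟩ := exists_abs_le_of_eq_zero_off hA.continuous hA0
  obtain ⟨MD, hMD⟩ := exists_abs_le_of_eq_zero_off hD.continuous hD0'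
  -- the complement of the characteristic domain of influence of `[α, β]`
  set Z : Set (ℝ × ℝ) := {p | (p.2 ≤ p.1 ∧ (p.1 < α ∨ β < p.2)) ∨ (p.1 ≤ p.2 ∧ (p.2 < α ∨ β < p.1))}
    with hZ
  have hZA : ∀ p ∈ Z, A p.1 = 0 := by
    rintro ⟨a, b⟩ hp
    apply hA0
    rintro ⟨h1, h2⟩
    rcases hp with ⟨hba, h | h⟩ | ⟨hab, h | h⟩ <;> dsimp only at * <;> linarith
  have hZD : ∀ p ∈ Z, D p.2 = 0 := by
    rintro ⟨a, b⟩ hp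
    apply hD0
    rcases hp with ⟨hba, h | h⟩ | ⟨hab, h | h⟩ <;> dsimp only at *
    · left; linarith
    · right; linarith
    · left; linarith
    · right; linarith
  have hZ1 : ∀ p ∈ Z, ∀ s ∈ uIcc p.2 p.1, (p.1, s) ∈ Z := by
    rintro ⟨a, b⟩ hp s hs
    rcases hp with ⟨hba, h | h⟩ | ⟨hab, h | h⟩ <;> dsimp only at *
    · rw [uIcc_of_le hba] at hs; exact Or.inl ⟨hs.2, Or.inl h⟩
    · rw [uIcc_of_le hba] at hs; exact Or.inl ⟨hs.2, Or.inr (lt_of_lt_of_le h hs.1)⟩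
    · rw [uIcc_of_ge hab] at hs; exact Or.inr ⟨hs.1, Or.inl (lt_of_le_of_lt hs.2 h)⟩
    · rw [uIcc_of_ge hab] at hs; exact Or.inr ⟨hs.1, Or.inr h⟩
  have hZ2 : ∀ p ∈ Z, ∀ s ∈ uIcc p.2 p.1, (s, p.2) ∈ Z := by
    rintro ⟨a, b⟩ hp s hs
    rcases hp with ⟨hba, h | h⟩ | ⟨hab, h | h⟩ <;> dsimp only at *
    · rw [uIcc_of_le hba] at hs; exact Or.inl ⟨hs.1, Or.inl (lt_of_le_of_lt hs.2 h)⟩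
    · rw [uIcc_of_le hba] at hs; exact Or.inl ⟨hs.1, Or.inr h⟩
    · rw [uIcc_of_ge hab] at hs; exact Or.inr ⟨hs.2, Or.inl h⟩
    · rw [uIcc_of_ge hab] at hs; exact Or.inr ⟨hs.2, Or.inr (lt_of_lt_of_le h hs.1)⟩
  -- Picard, with second datum `D`
  obtain ⟨Ψ, Q, hΨc, hQc, hΨ, hQ, hZ0⟩ := exists_picard_fixedPoint (A := A) (A' := D) hcc hcb
    hA.continuous hD.continuous hMA hMD Z hZA hZD hZ1 hZ2
  -- the bootstrap package (general diagonal datum)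
  set U : ℝ × ℝ → ℝ := uncurry Ψ with hU
  set Pf : ℝ × ℝ → ℝ := fun p => deriv A p.1 - Q p.1 p.1 - ∫ s in p.2..p.1, c p.1 s * Ψ p.1 s
    with hPf
  set Qf : ℝ × ℝ → ℝ := uncurry Q with hQf
  set cc : ℝ × ℝ → ℝ := fun p => c p.1 p.2 with hcc_def
  have hU2 : ContDiff ℝ 2 U := contDiff_two_psi hc hA hD hΨc hQc hΨ hQ
  have hP1 : ContDiff ℝ 1 Pf := contDiff_one_P hc hA hD hΨc hQc hΨ hQ
  have hQ1 : ContDiff ℝ 1 Qf := contDiff_one_Q hc hD hΨc hQc hΨ hQ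
  have hUd : ∀ p, HasFDerivAt U ((Pf p) • ContinuousLinearMap.fst ℝ ℝ ℝ +
      (Qf p) • ContinuousLinearMap.snd ℝ ℝ ℝ) p := fun p =>
    hasFDerivAt_psi hc hA hΨc hQc hΨ hQ p
  have hPb : ∀ p, fderiv ℝ Pf p (0, 1) = cc p * U p := fun p =>
    fderiv_P_snd hc hA hD hΨc hQc hΨ hQ p
  have hQa : ∀ p, fderiv ℝ Qf p (1, 0) = cc p * U p := fun p =>
    fderiv_Q_fst hc hD hΨc hQc hΨ hQ p
  -- the solution
  refine ⟨fun t x => U (x + t, x - t), contDiff_two_transfer hU2, ?_, ?_, ?_, ?_⟩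
  · -- the equation
    intro t x
    have h := iteratedDeriv_two_time_sub_space (U := U) hP1 hQ1 hUd hPb hQa t x
    have hcx : cc (x + t, x - t) = V x / 4 := by
      simp only [hcc_def, hc_def]
      congr 2; ring
    rw [hcx] at h
    have h' : iteratedDeriv 2 (fun τ => U (x + τ, x - τ)) t
        - iteratedDeriv 2 (fun y => U (y + t, y - t)) x = -(V x * U (x + t, x - t)) := by
      rw [h]; ring
    show iteratedDeriv 2 (fun τ => U (x + τ, x - τ)) t
        - iteratedDeriv 2 (fun y => U (y + t, y - t)) x + V x * U (x + t, x - t) = 0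
    rw [h']; ring
  · -- `ψ(0, ·) = A`
    intro x
    show U (x + 0, x - 0) = A x
    simp only [add_zero, sub_zero, hU, uncurry_apply_pair, hΨ x x, intervalIntegral.integral_same,
      sub_zero]
  · -- `ψ_t(0, ·) = B`
    intro x
    have h := hasDerivAt_transfer_time hUd (0 : ℝ) x
    rw [h.deriv]
    simp only [add_zero, sub_zero, hPf, hQf, uncurry_apply_pair, intervalIntegral.integral_same,
      sub_zero, hQ x x, add_zero, hD_def]
    ring
  · -- domain of influence
    intro t x hx
    have hmem : (x + t, x - t) ∈ Z := by
      rcases le_or_gt 0 t with ht | ht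
      · rw [abs_of_nonneg ht] at hx
        refine Or.inl ⟨by linarith, ?_⟩
        rcases hx with hx | hx
        · left; linarith
        · right; linarith
      · rw [abs_of_neg ht] at hx
        refine Or.inr ⟨by linarith, ?_⟩
        rcases hx with hx | hx
        · left; linarith
        · right; linarith
    exact (hZ0 _ hmem).1

/-- Closing the support condition: if `x ↦ ψ t x` is continuous and vanishes for `x < α − |t|` and
for `x > β + |t|`, it also vanishes at the two boundary points. -/
theorem eq_zero_of_closed_support {ψ : ℝ → ℝ → ℝ} (hψ : ∀ t, Continuous (ψ t)) {α β : ℝ}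
    (h : ∀ t x, (x < α - |t| ∨ β + |t| < x) → ψ t x = 0) (t x : ℝ)
    (hx : x + |t| ≤ α ∨ β + |t| ≤ x) : ψ t x = 0 := by
  have hclosed : IsClosed {y | ψ t y = 0} := isClosed_eq (hψ t) continuous_const
  rcases hx with hx | hx
  · have hsub : Iio (α - |t|) ⊆ {y | ψ t y = 0} := fun y hy => h t y (Or.inl hy)
    have hcl := hclosed.closure_subset_iff.2 hsub
    rw [closure_Iio] at hcl
    exact hcl (show x ∈ Iic (α - |t|) by simp only [mem_Iic]; linarith)
  · have hsub : Ioi (β + |t|) ⊆ {y | ψ t y = 0} := fun y hy => h t y (Or.inr hy)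
    have hcl := hclosed.closure_subset_iff.2 hsub
    rw [closure_Ioi] at hcl
    exact hcl (show x ∈ Ici (β + |t|) by simp only [mem_Ici]; linarith)

open Literature.Geometry.Lorentzian.ReggeWheeler

/-- The Regge–Wheeler line potentials along a tortoise radius function are `C¹`. -/
theorem contDiff_one_linePotential {M : ℝ} {r : ℝ → ℝ} {xc : ℝ} (h : IsTortoiseRadius M r xc)
    (s ℓ : ℕ) : ContDiff ℝ 1 (linePotential M s ℓ r) := by
  have hr : ContDiff ℝ 1 r := h.contDiff_one
  have hr0 : ∀ x, r x ≠ 0 := fun x => (h.pos x).ne'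
  unfold linePotential rwPotential
  refine (contDiff_const.sub (contDiff_const.div hr hr0)).mul
    ((contDiff_const.div (hr.pow 2) fun x => pow_ne_zero 2 (hr0 x)).add
      (contDiff_const.div (hr.pow 3) fun x => pow_ne_zero 3 (hr0 x)))

/-- The Regge–Wheeler line potentials along a tortoise radius function are bounded:
`|V_{s,ℓ}(r x)| ≤ (ℓ(ℓ+1)+1)/(2M)²` for `s ≤ ℓ`. -/
theorem abs_linePotential_le {M : ℝ} {r : ℝ → ℝ} {xc : ℝ} (h : IsTortoiseRadius M r xc)
    {s ℓ : ℕ} (hsℓ : s ≤ ℓ) (x : ℝ) :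
    |linePotential M s ℓ r x| ≤ ((ℓ : ℝ) * ((ℓ : ℝ) + 1) + 1) / (2 * M) ^ 2 := by
  have hM := h.mass_pos
  have h2 := h.two_mul_lt x
  have hV0 : 0 ≤ linePotential M s ℓ r x := linePotential_nonneg hM.le hsℓ h.two_mul_lt x
  rw [abs_of_nonneg hV0]
  have h1 : linePotential M s ℓ r x ≤ ((ℓ : ℝ) * ((ℓ : ℝ) + 1) + 1) / (r x) ^ 2 :=
    rwPotential_le_div_sq (s := s) (ℓ := ℓ) hM h2
  refine h1.trans ?_
  have hL : 0 ≤ (ℓ : ℝ) * ((ℓ : ℝ) + 1) + 1 := by positivity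
  apply div_le_div_of_nonneg_left hL (by positivity)
  exact pow_le_pow_left₀ (by positivity) h2.le 2

/-- **Registered stub `stub_rwCauchy`** of line `kruskal-rest-frame-virial` (item
stmt-FinalStateConjecture-10045): the `1+1` Cauchy problem for Regge–Wheeler with odd, compactly
supported `C²` velocity data `(0, g)`, including the domain of influence. -/
theorem stub_rwCauchy {M : ℝ} {r : ℝ → ℝ} {xc : ℝ} (hr : IsTortoiseRadius M r xc)
    (s ℓ : ℕ) (hsℓ : s ≤ ℓ) (g : ℝ → ℝ) (hg : ContDiff ℝ 2 g) (α β : ℝ)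
    (hsupp : ∀ x, x ≤ α ∨ β ≤ x → g x = 0) :
    ∃ ψ : ℝ → ℝ → ℝ, IsRWSolution M s ℓ r ψ ∧ (∀ x, ψ 0 x = 0) ∧
      (∀ x, deriv (fun τ => ψ τ x) 0 = g x) ∧
      ∀ t x, (x + |t| ≤ α ∨ β + |t| ≤ x) → ψ t x = 0 := by
  have hV : ContDiff ℝ 1 (linePotential M s ℓ r) := contDiff_one_linePotential hr s ℓ
  have hVb := abs_linePotential_le hr hsℓ
  have hA : ContDiff ℝ 2 (fun _ : ℝ => (0 : ℝ)) := contDiff_const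
  have hg0 : ∀ x, x ∉ Icc α β → g x = 0 := fun x hx => by
    apply hsupp
    by_contra hcon
    push Not at hcon
    exact hx ⟨hcon.1.le, hcon.2.le⟩
  obtain ⟨ψ, hψ2, hsol, h0, h1, hsup⟩ := exists_solution (A := fun _ => 0) (B := g) hV hVb hA
    (fun _ _ => rfl) (hg.of_le (by norm_num)) hg0
  refine ⟨ψ, ⟨hψ2, fun z => hsol z.1 z.2⟩, h0, h1, ?_⟩
  have hcont : ∀ t, Continuous (ψ t) := fun t =>
    hψ2.continuous.comp (continuous_const.prodMk continuous_id)
  exact eq_zero_of_closed_support hcont hsup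

end Summit.FinalStateConjecture.FinalStateConjecture.Theorems.CauchyWave

end
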